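import Mathlib
import HarnessLib
import Literature.NumberTheory.Transcendental.AssociatorsBarEval
import Summits.KontsevichZagierPeriods.KontsevichZagierPeriods.Theorems.FurushoPentagonKernelModuloPeriodConjectureLeafLowWeight
import Summits.KontsevichZagierPeriods.KontsevichZagierPeriods.Theorems.FurushoPentagonKernelModuloPeriodConjectureLeafCert
import Summits.KontsevichZagierPeriods.KontsevichZagierPeriods.Theorems.FurushoPentagonKernelModuloPeriodConjectureLeafTableLow

/-!
# `KernelModuloPeriodConjecture`, line `Sketch`: the algebraic leaf in weight 5

Crux `FurushoPentagon.KernelModuloPeriodConjecture` (stmt-KontsevichZagierPeriods-15058), line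
`Sketch`, registered stub `stub_associatorHoffmanSpanning` (the algebraic leaf
`AssociatorHoffmanSpanning`: Hoffman words span `𝒪(GroupLike ∩ Pent)` weight by weight). This file
proves the **weight-5 slice** unconditionally: for every admissible index `s` of weight 5 an
explicit rational certificate `c_{binaryWord s}(φ) = Σ_t b_t c_{binaryWord t}(φ)` (`t` Hoffman of
the same weight), valid at every group-like solution `φ` of Drinfeld's pentagon equation over every
commutative `ℚ`-algebra — part A of the identity table (the packaged leaf `associatorHoffmanSpanning_of_weight_eq_5` is in `LeafWeightFive`).

Method. For such `φ`: (i) `c_{x₁}(φ) = 0`, `c_{x₁ⁿ}(φ) = 0` (pentagon: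
`DrinfeldPentagon.apply_letter_eq_zero_of_isGroupLike`, `IsGroupLike.apply_replicate_eq_zero`);
(ii) shuffle products `c_u c_v = Σ_{w ∈ u ш v} c_w` (group-likeness), used for `u = x₁`
(regularisation of the words `x₁w`) and for pairs of convergent words (finite double shuffle);
(iii) the regularised stuffle identities `π_Y(φ)(s) π_Y(φ)(t) = Σ_{u ∈ s ∗ t} π_Y(φ)(u)` for `s`
admissible and `t = (1,…,1)` or `t` admissible — Furusho's double shuffle for pentagon solutions in
the coefficientwise form `DrinfeldPentagon.piY_mul_piY_eq_sum_stuffle` (tree theorem; Furusho 2011,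
§5). Products of lower-weight coefficients are rewritten through the lower-weight tables; the
resulting linear system in the coefficients `c_w`, `w ∈ {x₀,x₁}^{k-1}x₁`, and in the products of
Hoffman coefficients has corank `d_k` (Zagier's dimension) with the Hoffman words free — the
Ihara–Kaneko–Zagier verification of their Conjecture 1 in this weight, here for abstract pentagon
solutions. Certificates were found by exact linear algebra over `ℚ` (lead's generator
`work/gen/genlean.py`, folder of prover-line-stmt-KontsevichZagierPeriods-15058-c1) and are checked
by `linear_combination`; denominators are cleared (`D · c_w = Σ n_t c_t`).

References: K. Ihara, M. Kaneko, D. Zagier, *Derivation and double shuffle relations for multiple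
zeta values*, Compos. Math. 142 (2006), §1–§2 [IharaKanekoZagier2006]; H. Furusho, *Double shuffle
relation for associators*, Ann. of Math. 174 (2011), Thm 1.2, §5 [Furusho2011]; F. Brown, *Mixed
Tate motives over ℤ*, Ann. of Math. 175 (2012), Thm 1.1 [Brown2012].
-/

namespace Summit.KontsevichZagierPeriods.FurushoPentagon.KernelModuloPeriodConjecture

open Literature.NumberTheory.Transcendental

/-- Identity table in weight `5` (part A): admissible non-Hoffman indices and products of Hoffman
coefficients of total weight `5` in the Hoffman coordinates of weight `5` (denominators cleared), at
every group-like pentagon solution over every commutative `ℚ`-algebra; from the `x₁`-shuffle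
regularisation, the finite double shuffle and the Hoffman-type regularised stuffle identities, by
certificates found by exact `ℚ`-linear algebra. [cite: IharaKanekoZagier2006, §2] -/
theorem leafTable_weight5A {R : Type} [CommRing R] [Algebra ℚ R] {φ : NCSeries Bool R}
    (hg : NCSeries.IsGroupLike φ) (h5 : NCSeries.DrinfeldPentagon φ) :
    ((5 : R) * φ [false, false, false, false, true] = (-6) * φ [false, true, false, false, true] +
      (-4) * φ [false, false, true, false, true]) ∧
    ((5 : R) * φ [false, false, false, true, true] = 1 * φ [false, true, false, false, true] + (-1)
      * φ [false, false, true, false, true]) ∧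
    ((20 : R) * φ [false, false, true, true, true] = (-4) * φ [false, true, false, false, true] + 4
      * φ [false, false, true, false, true]) ∧
    ((4 : R) * φ [false, true, false, true, true] = (-4) * φ [false, false, true, false, true]) ∧
    ((4 : R) * φ [false, true, true, false, true] = (-4) * φ [false, true, false, false, true]) ∧
    ((10 : R) * φ [false, true, true, true, true] = 12 * φ [false, true, false, false, true] + 8 * φ
      [false, false, true, false, true]) ∧
    ((5 : R) * (φ [false, true] * φ [false, false, true]) = 11 * φ [false, true, false, false, true]
      + 9 * φ [false, false, true, false, true]) := by
  have hy : φ [true] = 0 := h5.apply_letter_eq_zero_of_isGroupLike hg true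
  have z1 : φ [true] = 0 := by
    simpa using leafCert_replicate_true hg h5 1 (by norm_num)
  have z2 : φ [true, true] = 0 := by
    simpa using leafCert_replicate_true hg h5 2 (by norm_num)
  have pY_1 : NCSeries.piY φ [1] = -φ [true] := leafCert_piY_odd φ (by decide) (by decide) (by
    decide)
  have pY_11 : NCSeries.piY φ [1, 1] = φ [true, true] := leafCert_piY_even φ (by decide) (by decide)
    (by decide)
  have pY_2 : NCSeries.piY φ [2] = -φ [false, true] := leafCert_piY_odd φ (by decide) (by decide)
    (by decide)
  have pY_21 : NCSeries.piY φ [2, 1] = φ [false, true, true] := leafCert_piY_even φ (by decide) (by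
    decide) (by decide)
  have pY_3 : NCSeries.piY φ [3] = -φ [false, false, true] := leafCert_piY_odd φ (by decide) (by
    decide) (by decide)
  have pY_22 : NCSeries.piY φ [2, 2] = φ [false, true, false, true] := leafCert_piY_even φ (by
    decide) (by decide) (by decide)
  have pY_31 : NCSeries.piY φ [3, 1] = φ [false, false, true, true] := leafCert_piY_even φ (by
    decide) (by decide) (by decide)
  have pY_4 : NCSeries.piY φ [4] = -φ [false, false, false, true] := leafCert_piY_odd φ (by decide)
    (by decide) (by decide)
  have pY_1121 : NCSeries.piY φ [1, 1, 2, 1] = φ [true, true, false, true, true] :=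
    leafCert_piY_even φ (by decide) (by decide) (by decide)
  have pY_1211 : NCSeries.piY φ [1, 2, 1, 1] = φ [true, false, true, true, true] :=
    leafCert_piY_even φ (by decide) (by decide) (by decide)
  have pY_122 : NCSeries.piY φ [1, 2, 2] = -φ [true, false, true, false, true] := leafCert_piY_odd φ
    (by decide) (by decide) (by decide)
  have pY_131 : NCSeries.piY φ [1, 3, 1] = -φ [true, false, false, true, true] := leafCert_piY_odd φ
    (by decide) (by decide) (by decide)
  have pY_14 : NCSeries.piY φ [1, 4] = φ [true, false, false, false, true] := leafCert_piY_even φ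
    (by decide) (by decide) (by decide)
  have pY_2111 : NCSeries.piY φ [2, 1, 1, 1] = φ [false, true, true, true, true] :=
    leafCert_piY_even φ (by decide) (by decide) (by decide)
  have pY_212 : NCSeries.piY φ [2, 1, 2] = -φ [false, true, true, false, true] := leafCert_piY_odd φ
    (by decide) (by decide) (by decide)
  have pY_221 : NCSeries.piY φ [2, 2, 1] = -φ [false, true, false, true, true] := leafCert_piY_odd φ
    (by decide) (by decide) (by decide)
  have pY_23 : NCSeries.piY φ [2, 3] = φ [false, true, false, false, true] := leafCert_piY_even φ
    (by decide) (by decide) (by decide)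
  have pY_311 : NCSeries.piY φ [3, 1, 1] = -φ [false, false, true, true, true] := leafCert_piY_odd φ
    (by decide) (by decide) (by decide)
  have pY_32 : NCSeries.piY φ [3, 2] = φ [false, false, true, false, true] := leafCert_piY_even φ
    (by decide) (by decide) (by decide)
  have pY_41 : NCSeries.piY φ [4, 1] = φ [false, false, false, true, true] := leafCert_piY_even φ
    (by decide) (by decide) (by decide)
  have pY_5 : NCSeries.piY φ [5] = -φ [false, false, false, false, true] := leafCert_piY_odd φ (by
    decide) (by decide) (by decide)
  have f_011 := leafNF_011 hg h5
  have r0 := hg.mul_eq_sum_shuffleWord [true] [false, false, false, true]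
  simp only [MZV.shuffleWord_cons_cons, MZV.shuffleWord_nil_left, MZV.shuffleWord_nil_right,
    List.map_cons, List.map_nil, List.cons_append, List.nil_append, List.sum_cons, List.sum_nil,
    add_zero] at r0
  have r1 := hg.mul_eq_sum_shuffleWord [true] [false, false, true, true]
  simp only [MZV.shuffleWord_cons_cons, MZV.shuffleWord_nil_left, MZV.shuffleWord_nil_right,
    List.map_cons, List.map_nil, List.cons_append, List.nil_append, List.sum_cons, List.sum_nil,
    add_zero] at r1
  have r2 := hg.mul_eq_sum_shuffleWord [true] [false, true, false, true]
  simp only [MZV.shuffleWord_cons_cons, MZV.shuffleWord_nil_left, MZV.shuffleWord_nil_right,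
    List.map_cons, List.map_nil, List.cons_append, List.nil_append, List.sum_cons, List.sum_nil,
    add_zero] at r2
  have r3 := hg.mul_eq_sum_shuffleWord [true] [false, true, true, true]
  simp only [MZV.shuffleWord_cons_cons, MZV.shuffleWord_nil_left, MZV.shuffleWord_nil_right,
    List.map_cons, List.map_nil, List.cons_append, List.nil_append, List.sum_cons, List.sum_nil,
    add_zero] at r3
  have r5 := hg.mul_eq_sum_shuffleWord [true] [true, false, true, true]
  simp only [MZV.shuffleWord_cons_cons, MZV.shuffleWord_nil_left, MZV.shuffleWord_nil_right,
    List.map_cons, List.map_nil, List.cons_append, List.nil_append, List.sum_cons, List.sum_nil,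
    add_zero] at r5
  have r8 := hg.mul_eq_sum_shuffleWord [false, true] [false, true, true]
  simp only [MZV.shuffleWord_cons_cons, MZV.shuffleWord_nil_left, MZV.shuffleWord_nil_right,
    List.map_cons, List.map_nil, List.cons_append, List.nil_append, List.sum_cons, List.sum_nil,
    add_zero] at r8
  have r9 := hg.mul_eq_sum_shuffleWord [false, true] [false, false, true]
  simp only [MZV.shuffleWord_cons_cons, MZV.shuffleWord_nil_left, MZV.shuffleWord_nil_right,
    List.map_cons, List.map_nil, List.cons_append, List.nil_append, List.sum_cons, List.sum_nil,
    add_zero] at r9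
  have e12 := h5.piY_mul_piY_eq_sum_stuffle hg (s := [2]) (t := [3])
    ⟨by decide, by decide⟩ (by decide) (by decide) (by decide)
  simp only [MZV.stuffle_cons_cons, MZV.stuffle_nil_left, MZV.stuffle_nil_right, List.map_cons,
    List.map_nil, List.cons_append, List.nil_append, List.sum_cons, List.sum_nil, add_zero,
    Nat.reduceAdd, pY_2, pY_3, pY_23, pY_32, pY_5] at e12
  have e13 := h5.piY_mul_piY_eq_sum_stuffle hg (s := [2, 1]) (t := [1, 1])
    ⟨by decide, by decide⟩ (by decide) (by decide) (by decide)
  simp only [MZV.stuffle_cons_cons, MZV.stuffle_nil_left, MZV.stuffle_nil_right, List.map_cons,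
    List.map_nil, List.cons_append, List.nil_append, List.sum_cons, List.sum_nil, add_zero,
    Nat.reduceAdd, pY_11, pY_21, pY_1121, pY_1211, pY_122, pY_131, pY_2111, pY_212, pY_221, pY_311,
    pY_32] at e13
  have e18 := h5.piY_mul_piY_eq_sum_stuffle hg (s := [2, 2]) (t := [1])
    ⟨by decide, by decide⟩ (by decide) (by decide) (by decide)
  simp only [MZV.stuffle_cons_cons, MZV.stuffle_nil_left, MZV.stuffle_nil_right, List.map_cons,
    List.map_nil, List.cons_append, List.nil_append, List.sum_cons, List.sum_nil, add_zero,
    Nat.reduceAdd, pY_1, pY_22, pY_122, pY_212, pY_221, pY_23, pY_32] at e18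
  have e19 := h5.piY_mul_piY_eq_sum_stuffle hg (s := [3, 1]) (t := [1])
    ⟨by decide, by decide⟩ (by decide) (by decide) (by decide)
  simp only [MZV.stuffle_cons_cons, MZV.stuffle_nil_left, MZV.stuffle_nil_right, List.map_cons,
    List.map_nil, List.cons_append, List.nil_append, List.sum_cons, List.sum_nil, add_zero,
    Nat.reduceAdd, pY_1, pY_31, pY_131, pY_311, pY_32, pY_41] at e19
  have e20 := h5.piY_mul_piY_eq_sum_stuffle hg (s := [4]) (t := [1])
    ⟨by decide, by decide⟩ (by decide) (by decide) (by decide)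
  simp only [MZV.stuffle_cons_cons, MZV.stuffle_nil_left, MZV.stuffle_nil_right, List.map_cons,
    List.map_nil, List.cons_append, List.nil_append, List.sum_cons, List.sum_nil, add_zero,
    Nat.reduceAdd, pY_1, pY_4, pY_14, pY_41, pY_5] at e20
  refine ⟨?_, ?_, ?_, ?_, ?_, ?_, ?_⟩
  · linear_combination (-6) * r0 + (6) * φ [false, false, false, true] * hy + r9 + (-1) * e12 + (6)
      * e20 + (-6) * φ [false, false, false, true] * z1
  · linear_combination r0 + (-1) * φ [false, false, false, true] * hy + (-1) * r9 + e12 + (-1) * e20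
      + φ [false, false, false, true] * z1
  · linear_combination (-4) * r0 + (4) * φ [false, false, false, true] * hy + (10) * r1 + (-10) * φ
      [false, false, true, true] * hy + (5) * r2 + (-5) * φ [false, true, false, true] * hy + (-5) *
      r8 + (5) * (1 * φ [false, true]) * f_011 + (-1) * r9 + (-4) * e12 + (5) * e18 + (5) * φ
      [false, true, false, true] * z1 + (10) * e19 + (10) * φ [false, false, true, true] * z1 + (4)
      * e20 + (-4) * φ [false, false, false, true] * z1
  · linear_combination (-6) * r1 + (6) * φ [false, false, true, true] * hy + (-1) * r2 + φ [false,
      true, false, true] * hy + r8 + (-1) * (1 * φ [false, true]) * f_011 + r9 + (-1) * e18 + (-1) *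
      φ [false, true, false, true] * z1 + (-6) * e19 + (-6) * φ [false, false, true, true] * z1
  · linear_combination (6) * r1 + (-6) * φ [false, false, true, true] * hy + (-3) * r2 + (3) * φ
      [false, true, false, true] * hy + (-1) * r8 + (1 * φ [false, true]) * f_011 + (-1) * r9 + (-3)
      * e18 + (-3) * φ [false, true, false, true] * z1 + (6) * e19 + (6) * φ [false, false, true,
      true] * z1
  · linear_combination (2) * r0 + (-2) * φ [false, false, false, true] * hy + (5) * r3 + (-5) * φ
      [false, true, true, true] * hy + (5) * r5 + (-5) * φ [true, false, true, true] * hy + (-2) *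
      r9 + (2) * e12 + (-10) * e13 + (10) * φ [false, true, true] * z2 + (10) * e18 + (10) * φ
      [false, true, false, true] * z1 + (10) * e19 + (10) * φ [false, false, true, true] * z1 + (-2)
      * e20 + (2) * φ [false, false, false, true] * z1
  · linear_combination (6) * r0 + (-6) * φ [false, false, false, true] * hy + (-1) * r9 + (6) * e12
      + (-6) * e20 + (6) * φ [false, false, false, true] * z1

/-- Hoffman reduction of `c_{x₀x₀x₀x₀x₁}` in weight `5` at every group-like pentagon solution over
every
commutative `ℚ`-algebra (at `Φ_KZ`: `ζ(5) = 6/5 ζ(2,3) + 4/5 ζ(3,2)`). [cite: IharaKanekoZagier2006, §2] -/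
theorem leafNF_00001 {R : Type} [CommRing R] [Algebra ℚ R] {φ : NCSeries Bool R}
    (hg : NCSeries.IsGroupLike φ) (h5 : NCSeries.DrinfeldPentagon φ) :
    (5 : R) * φ [false, false, false, false, true] = (-6) * φ [false, true, false, false, true] +
      (-4) * φ [false, false, true, false, true] :=
  (leafTable_weight5A hg h5).1

/-- Hoffman reduction of `c_{x₀x₀x₀x₁x₁}` in weight `5` at every group-like pentagon solution over
every
commutative `ℚ`-algebra (at `Φ_KZ`: `ζ(4,1) = 1/5 ζ(2,3) - 1/5 ζ(3,2)`). [cite: IharaKanekoZagier2006, §2] -/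
theorem leafNF_00011 {R : Type} [CommRing R] [Algebra ℚ R] {φ : NCSeries Bool R}
    (hg : NCSeries.IsGroupLike φ) (h5 : NCSeries.DrinfeldPentagon φ) :
    (5 : R) * φ [false, false, false, true, true] = 1 * φ [false, true, false, false, true] + (-1) *
      φ [false, false, true, false, true] :=
  (leafTable_weight5A hg h5).2.1

/-- Hoffman reduction of `c_{x₀x₀x₁x₁x₁}` in weight `5` at every group-like pentagon solution over
every
commutative `ℚ`-algebra (at `Φ_KZ`: `ζ(3,1,1) = 1/5 ζ(2,3) - 1/5 ζ(3,2)`). [cite: IharaKanekoZagier2006, §2] -/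
theorem leafNF_00111 {R : Type} [CommRing R] [Algebra ℚ R] {φ : NCSeries Bool R}
    (hg : NCSeries.IsGroupLike φ) (h5 : NCSeries.DrinfeldPentagon φ) :
    (5 : R) * φ [false, false, true, true, true] = (-1) * φ [false, true, false, false, true] + 1 *
      φ [false, false, true, false, true] :=
  leafNF_cancel (g := 4) (by norm_num) (by linear_combination (leafTable_weight5A hg h5).2.2.1)

/-- Hoffman reduction of `c_{x₀x₁x₀x₁x₁}` in weight `5` at every group-like pentagon solution over
every
commutative `ℚ`-algebra (at `Φ_KZ`: `ζ(2,2,1) = 1 ζ(3,2)`). [cite: IharaKanekoZagier2006, §2] -/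
theorem leafNF_01011 {R : Type} [CommRing R] [Algebra ℚ R] {φ : NCSeries Bool R}
    (hg : NCSeries.IsGroupLike φ) (h5 : NCSeries.DrinfeldPentagon φ) :
    (1 : R) * φ [false, true, false, true, true] = (-1) * φ [false, false, true, false, true] :=
  leafNF_cancel (g := 4) (by norm_num) (by linear_combination (leafTable_weight5A hg h5).2.2.2.1)

/-- Hoffman reduction of `c_{x₀x₁x₁x₀x₁}` in weight `5` at every group-like pentagon solution over
every
commutative `ℚ`-algebra (at `Φ_KZ`: `ζ(2,1,2) = 1 ζ(2,3)`). [cite: IharaKanekoZagier2006, §2] -/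
theorem leafNF_01101 {R : Type} [CommRing R] [Algebra ℚ R] {φ : NCSeries Bool R}
    (hg : NCSeries.IsGroupLike φ) (h5 : NCSeries.DrinfeldPentagon φ) :
    (1 : R) * φ [false, true, true, false, true] = (-1) * φ [false, true, false, false, true] :=
  leafNF_cancel (g := 4) (by norm_num) (by linear_combination (leafTable_weight5A hg h5).2.2.2.2.1)

/-- Hoffman reduction of `c_{x₀x₁x₁x₁x₁}` in weight `5` at every group-like pentagon solution over
every
commutative `ℚ`-algebra (at `Φ_KZ`: `ζ(2,1,1,1) = 6/5 ζ(2,3) + 4/5 ζ(3,2)`). [cite: IharaKanekoZagier2006, §2] -/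
theorem leafNF_01111 {R : Type} [CommRing R] [Algebra ℚ R] {φ : NCSeries Bool R}
    (hg : NCSeries.IsGroupLike φ) (h5 : NCSeries.DrinfeldPentagon φ) :
    (5 : R) * φ [false, true, true, true, true] = 6 * φ [false, true, false, false, true] + 4 * φ
      [false, false, true, false, true] :=
  leafNF_cancel (g := 2) (by norm_num) (by linear_combination (leafTable_weight5A hg h5).2.2.2.2.2.1)

/-- The product `c_{x₀x₁} c_{x₀x₀x₁}` of Hoffman coefficients in the Hoffman coordinates of
weight `5` at every group-like pentagon solution (at `Φ_KZ`: `ζ(2)ζ(3) = 11/5 ζ(2,3) + 9/5 ζ(3,2)`).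
[cite: IharaKanekoZagier2006, §2] -/
theorem leafNF_m_01_001 {R : Type} [CommRing R] [Algebra ℚ R] {φ : NCSeries Bool R}
    (hg : NCSeries.IsGroupLike φ) (h5 : NCSeries.DrinfeldPentagon φ) :
    (5 : R) * (φ [false, true] * φ [false, false, true]) = 11 * φ [false, true, false, false, true]
      + 9 * φ [false, false, true, false, true] :=
  (leafTable_weight5A hg h5).2.2.2.2.2.2

/-- **Registered sub-goal `stub_leafTable5A`** (crux stmt-KontsevichZagierPeriods-15058, line `Sketch`): the
weight-`5` identity table part A in `∀`-form (`leafTable_weight5A`). [cite: IharaKanekoZagier2006, §2] -/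
theorem stub_leafTable5A : ∀ (R : Type) [CommRing R] [Algebra ℚ R] (φ : NCSeries Bool R), NCSeries.IsGroupLike φ → NCSeries.DrinfeldPentagon φ → ((5 : R) * φ [false, false, false, false, true] = (-6) * φ [false, true, false, false, true] + (-4) * φ [false, false, true, false, true]) ∧ ((5 : R) * φ [false, false, false, true, true] = 1 * φ [false, true, false, false, true] + (-1) * φ [false, false, true, false, true]) ∧ ((20 : R) * φ [false, false, true, true, true] = (-4) * φ [false, true, false, false, true] + 4 * φ [false, false, true, false, true]) ∧ ((4 : R) * φ [false, true, false, true, true] = (-4) * φ [false, false, true, false, true]) ∧ ((4 : R) * φ [false, true, true, false, true] = (-4) * φ [false, true, false, false, true]) ∧ ((10 : R) * φ [false, true, true, true, true] = 12 * φ [false, true, false, false, true] + 8 * φ [false, false, true, false, true]) ∧ ((5 : R) * (φ [false, true] * φ [false, false, true]) = 11 * φ [false, true, false, false, true] + 9 * φ [false, false, true, false, true]) :=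
  fun _ _ _ _ hg h5 => leafTable_weight5A hg h5

end Summit.KontsevichZagierPeriods.FurushoPentagon.KernelModuloPeriodConjecture
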